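import Summits.HodgeConjecture.HodgeConjecture.Theorems.R90S4TwistedTubeFibres            -- ★ p864729 (this seat) `mem_epsCentralizer_base_iff` (brings ★ p863295 `R90S4CartanNormMap`, ★ M1 `exists_twistedConjFamily`, ★ WEYL-ε `exists_epsNormalizer`, `splitFormGL_isHermitian`)
import Summits.HodgeConjecture.HodgeConjecture.Theorems.R90S4BorelNormSection            -- ★ p864367 (K2E5-p17) (L2) `exists_measurable_epsNormSection`
import Summits.HodgeConjecture.HodgeConjecture.Theorems.R90S4NormTransversalOfCover      -- ★ (K2E5-p17) `exists_normTransversal_of_cover_splitFormGL`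
import Summits.HodgeConjecture.HodgeConjecture.Theorems.R90S4NormStableClassBijection    -- ★ `exists_epsNorm_eq_coe`
import Literature.NumberTheory.Rogawski1990.LocalCentralizerTorusMeasureCM               -- ★ `compactCore_centralizer_facts_of_isRegularElt_G` (commutative, compact open core on the `G_v` side)
import Literature.NumberTheory.Automorphic.CompactCoreCentralizerNonarch                 -- ★ `exists_isHaarMeasure_compactCore_eq_one`
import Literature.NumberTheory.Automorphic.OrbitalMeasureCanonical                       -- ★ `compactCore`, `image_compactCore`
import Literature.NumberTheory.Automorphic.LocalUnitaryGroupCongrMeasure                 -- ★ `locallyCompactSpace_localGL`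
import HarnessLib

/-!
# R90-TF · S4 «Ch. 13.1–2», T-WIF road, (B1-Σ) head §1a — THE PER-MEMBER APPARATUS OF THE TWISTED TUBE: every object and letter the (J̃♭) socket quantifies over, PRODUCED
# from ★ (base point `δ₀`, core-one Haar `τ′` on `G̃_{δ₀ε}`, tube map `Ψ`, ε-normaliser `Ñ`, Borel norm section `s`, sheet transversal `R`) (Rogawski 1990, §12.5 p. 186; §4.3 p. 43)

Cell `hodgecm-mathlib`, crux H413 (`stmt-HodgeConjecture-24833`, lane `--supports … --as helper`), route of record `HCCMUnconditional` (no route verbs; count-neutral).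
Programme R90-TF, section S4 = [Rogawski1990] Ch. 13.1–13.2; seat R90-C131-p03 (g3); dealt S4-R71 (dealer K2E2-plan (g8), 2026-09-05 03:20:51Z): the `∃`-bundle consumed by
K2E3-p36 (g4)'s Σ-head `R90S4TwistedWeylMeasureOfTubeJacobians` §1 when it instantiates C ED. 6's (J̃♭) socket `stub_R90_S4_twistedTubeJacobian` (typ1 (g2) v3.3 :119–:158) at a
member `T = ↑i`.  THEOREMS ONLY — no `def`, no instance, no notation, no named-fact hypothesis, no `sorry`; ★-only imports.

HONEST LABEL: HC_CM is proved only modulo the 7 printed citations (2 remaining named inputs: hLiu418 = stmt-HodgeConjecture-24832, h413 =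
stmt-HodgeConjecture-24833) until rung 0 closes.  Unconditional lemmas (for non-split `v` via `hns` in §2); discharge no socket (REL ≠ ★ ≠ BUILT).

## The mathematics

For a Cartan member `T = Cent_{G_v}(γ₀)` of `G_v = U(Φ₃)(L⁺_v)` (`γ₀` regular) with `T̃ := Cent_{G̃_v}(γ₀)`:
* §1 `τ′`: for any ε-regular `δ₀ ∈ T̃`, the ε-centraliser `T′ = G̃_{δ₀ε}` is the image of `T` by the identity (★ `exists_continuousMulEquiv_epsCentralizer_of_mem_centralizer`), so the three
  compact-core facts of `T` (commutative, compact open core — ★ Literature) transfer (★ `image_compactCore`) and `T′` carries an inversion-invariant Haar measure with core mass `1`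
  (★ `exists_isHaarMeasure_compactCore_eq_one`) — the `(τ')(h1)` row of ★ β's CAN-ID.
* §2 THE BUNDLE: `δ₀` with `N δ₀ = γ₀` (★ `exists_epsNorm_eq_coe`; it lies in `T̃` and is ε-regular since `γ₀` is regular); `τ′` by §1; the twisted family `Ψ(xT′, b) = x b ε(x)⁻¹`
  (★ M1 `exists_twistedConjFamily`: `T′ = {g ∈ T̃ | ε g = g}` ★ `mem_epsCentralizer_base_iff` is ε-fixed and central in the abelian `T̃`); the ε-normaliser `Ñ` (★ `exists_epsNormalizer`);
  a Borel norm section `s : T → T̃`, `N(s t) = t` (★ (L2) `exists_measurable_epsNormSection`, codomain restricted); a norm-one sheet transversal `R` of `T̃ᴺ` modulo `(1−ε)T̃`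
  (★ `exists_normTransversal_of_cover_splitFormGL`, non-split `v`).

[cite: Rogawski1990, §12.5 p. 186; §4.3 (4.3.1) p. 43; §3.11 Prop. 3.11.1–3.11.2 pp. 34–35] [cite: Tits1979, §3.9] [cite: Kechris1995, Thm. 12.13]
-/

set_option autoImplicit false
-- the mandated namespace repeats the single-problem summit's segment (`HodgeConjecture.HodgeConjecture`)
set_option linter.dupNamespace false

noncomputable section

open MeasureTheory Measure Set Filter Topology Function NumberField IsDedekindDomain
open scoped ENNReal NNReal Matrix MatrixGroups Pointwise

namespace Summit.HodgeConjecture.HodgeConjecture.R90.S4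

open Literature.NumberTheory.Rogawski1990 Literature.NumberTheory.Rogawski1990.Ch4Sec10
open Literature.NumberTheory.Automorphic Literature.NumberTheory.Automorphic.UnitaryGroup

section Apparatus

variable {L : Type} [Field L] [NumberField L] [IsCMField L] {v : HeightOneSpectrum (𝓞 ↥(maximalRealSubfield L))}

/-! ## §1 The core-one Haar measure on `T′ = G̃_{δ₀ε}` -/

/-- **THE CORE-ONE HAAR MEASURE ON `T′ = G̃_{δ₀ε}`**: for `γ₀ ∈ G_v` regular and `δ₀ ∈ Cent_{G̃_v}(γ₀)` ε-regular there is a Haar measure `τ′` on the ε-centraliser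
`epsCentralizer ε δ₀`, inversion invariant, with `τ′(compact core) = 1` — transferred along the identity isomorphism `G̃_{δ₀ε} ≃ₜ* Cent_{G_v}(γ₀)` (★ p863295) from the three
compact-core facts of the Cartan subgroup (★ Literature). [cite: Rogawski1990, §4.3 (4.3.1) p. 43; §12.5 p. 186] [cite: Tits1979, §3.9] -/
theorem exists_isHaarMeasure_epsCentralizer_compactCore_eq_one [MeasurableSpace (GtLoc L v)] [BorelSpace (GtLoc L v)]
    {γ₀ : (UnitaryGroup.cmDatum L 3 (splitFormGL L : Matrix (Fin 3) (Fin 3) L)).Local v} (hγ₀ : IsRegularElt (γ₀.val : GtLoc L v))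
    {δ₀ : GtLoc L v} (hδ₀T : δ₀ ∈ Subgroup.centralizer ({(γ₀.val : GtLoc L v)} : Set (GtLoc L v))) (hδ₀reg : IsEpsRegularAt L (splitFormGL L) v δ₀) :
    ∃ τ' : Measure ↥(epsCentralizer (epsLoc L (splitFormGL L) v) δ₀), τ'.IsHaarMeasure ∧ τ'.IsInvInvariant ∧
      τ' (compactCore ↥(epsCentralizer (epsLoc L (splitFormGL L) v) δ₀)) = 1 := by
  have hΦ := splitFormGL_isHermitian L
  haveI : LocallyCompactSpace (GtLoc L v) := locallyCompactSpace_localGL (E := L) 3 v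
  haveI : LocallyCompactSpace ↥(epsCentralizer (epsLoc L (splitFormGL L) v) δ₀) :=
    (isClosed_epsCentralizer L (splitFormGL L) v δ₀).isClosedEmbedding_subtypeVal.locallyCompactSpace
  obtain ⟨e, -⟩ := exists_continuousMulEquiv_epsCentralizer_of_mem_centralizer hΦ hγ₀ hδ₀T hδ₀reg
  have hH' : ((splitFormGL L : Matrix (Fin 3) (Fin 3) L).map (IsCMField.complexConj L))ᵀ = (splitFormGL L : Matrix (Fin 3) (Fin 3) L) := by
    rw [← Matrix.transpose_map]; exact hΦ
  have hH'd : IsUnit (splitFormGL L : Matrix (Fin 3) (Fin 3) L).det := (Matrix.isUnit_iff_isUnit_det _).1 (splitFormGL L).isUnit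
  obtain ⟨hcommG, hcG, hoG⟩ := compactCore_centralizer_facts_of_isRegularElt_G L (splitFormGL L : Matrix (Fin 3) (Fin 3) L) hH' hH'd v γ₀ hγ₀
  -- transfer the three facts along `e.symm`
  have hcomm : ∀ a b : ↥(epsCentralizer (epsLoc L (splitFormGL L) v) δ₀), a * b = b * a := fun a b =>
    e.injective (by rw [map_mul, map_mul, hcommG])
  have hc : IsCompact (compactCore ↥(epsCentralizer (epsLoc L (splitFormGL L) v) δ₀)) := by
    rw [← image_compactCore e.symm]
    exact hcG.image e.symm.continuous
  have ho : IsOpen (compactCore ↥(epsCentralizer (epsLoc L (splitFormGL L) v) δ₀)) := by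
    rw [← image_compactCore e.symm]
    exact e.symm.toHomeomorph.isOpenMap _ hoG
  exact exists_isHaarMeasure_compactCore_eq_one hcomm hc ho


/-! ## §2 The bundle -/

/-- **THE PER-MEMBER APPARATUS OF THE TWISTED TUBE, FROM ★** (`v` non-split): for a Cartan member `T = Cent_{G_v}(γ₀)` (`γ₀` regular; carrier `Gqs L v` as in C's Cartan data)
there EXIST — an ε-regular base point `δ₀ ∈ T̃ = Cent_{G̃_v}(γ₀)` (`N δ₀ = γ₀`); a Haar measure `τ′` on `G̃_{δ₀ε}`, inversion invariant, core mass `1` (§1); the twisted family `Ψ` with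
`Ψ(xT′, b) = x b ε(x)⁻¹` (★ M1); an ε-normaliser `Ñ` with its membership predicate (★ WEYL-ε); a MEASURABLE norm section `s : T → T̃` with `N(s t) = t` (★ (L2)); and a norm-one
transversal `R ⊆ T̃` of `T̃ᴺ ⧸ (1−ε)T̃` with its three letters (★ K-FIN ⇒ transversal) — i.e. every object and letter the (J̃♭) socket of C ED. 6 quantifies over besides
`(νGt, T, γ₀, hγ₀, hT, tT, htc)`, in the socket's own bytes. [cite: Rogawski1990, §12.5 p. 186; §4.3 (4.3.1) p. 43; §3.11 Prop. 3.11.1–3.11.2 pp. 34–35] -/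
theorem exists_twistedTubeApparatus (hns : ∀ w : PlacesOver L v, IsCMField.complexConj L • w.1 = w.1)
    [MeasurableSpace (GtLoc L v)] [BorelSpace (GtLoc L v)] [MeasurableSpace (Gqs L v)] [BorelSpace (Gqs L v)]
    {T : Subgroup (Gqs L v)} {γ₀ : Gqs L v} (hγ₀ : IsRegularElt (γ₀.val : GtLoc L v)) (hT : T = Subgroup.centralizer ({γ₀} : Set (Gqs L v))) :
    ∃ (δ₀ : GtLoc L v) (_ : δ₀ ∈ (Subgroup.centralizer ({(γ₀.val : GtLoc L v)} : Set (GtLoc L v)))) (_ : IsEpsRegularAt L (splitFormGL L) v δ₀)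
      (τ' : Measure ↥(epsCentralizer (epsLoc L (splitFormGL L) v) δ₀)) (_ : τ'.IsHaarMeasure) (_ : τ'.IsInvInvariant)
      (_ : τ' (compactCore ↥(epsCentralizer (epsLoc L (splitFormGL L) v) δ₀)) = 1)
      (Ψ : (GtLoc L v ⧸ epsCentralizer (epsLoc L (splitFormGL L) v) δ₀) × ↥(Subgroup.centralizer ({(γ₀.val : GtLoc L v)} : Set (GtLoc L v))) → GtLoc L v)
      (_ : ∀ (x : GtLoc L v) (b : ↥(Subgroup.centralizer ({(γ₀.val : GtLoc L v)} : Set (GtLoc L v)))), Ψ (QuotientGroup.mk x, b) = x * b * ((epsLoc L (splitFormGL L) v) x)⁻¹)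
      (N' : Subgroup (GtLoc L v))
      (_ : ∀ m : GtLoc L v, m ∈ N' ↔ m ∈ Subgroup.normalizer ((Subgroup.centralizer ({(γ₀.val : GtLoc L v)} : Set (GtLoc L v))) : Set (GtLoc L v)) ∧ m * ((epsLoc L (splitFormGL L) v) m)⁻¹ ∈ (Subgroup.centralizer ({(γ₀.val : GtLoc L v)} : Set (GtLoc L v))))
      (s : ↥T → ↥(Subgroup.centralizer ({(γ₀.val : GtLoc L v)} : Set (GtLoc L v)))) (_ : Measurable s) (_ : ∀ t : ↥T, epsNorm (epsLoc L (splitFormGL L) v) (s t : GtLoc L v) = ((t : Gqs L v)).val)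
      (R : Finset ↥(Subgroup.centralizer ({(γ₀.val : GtLoc L v)} : Set (GtLoc L v)))),
      (∀ u ∈ R, epsNorm (epsLoc L (splitFormGL L) v) (u : GtLoc L v) = 1) ∧
      (∀ w : ↥(Subgroup.centralizer ({(γ₀.val : GtLoc L v)} : Set (GtLoc L v))), epsNorm (epsLoc L (splitFormGL L) v) (w : GtLoc L v) = 1 → ∃ u ∈ R, ∃ a : ↥(Subgroup.centralizer ({(γ₀.val : GtLoc L v)} : Set (GtLoc L v))), (w : GtLoc L v) = u * (a * ((epsLoc L (splitFormGL L) v) a)⁻¹)) ∧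
      (∀ u ∈ R, ∀ u' ∈ R, (∃ a : ↥(Subgroup.centralizer ({(γ₀.val : GtLoc L v)} : Set (GtLoc L v))), ((u' : ↥(Subgroup.centralizer ({(γ₀.val : GtLoc L v)} : Set (GtLoc L v)))) : GtLoc L v) = u * (a * ((epsLoc L (splitFormGL L) v) a)⁻¹)) → u = u') := by
  have hΦ := splitFormGL_isHermitian L
  -- the base point: a norm preimage of `γ₀` commuting with `γ₀`
  obtain ⟨δ₀, hN, hδγ, -⟩ := exists_epsNorm_eq_coe L (splitFormGL L) v γ₀
  have hδ₀T : δ₀ ∈ (Subgroup.centralizer ({(γ₀.val : GtLoc L v)} : Set (GtLoc L v))) := Subgroup.mem_centralizer_singleton_iff.2 hδγ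
  have hδ₀reg : IsEpsRegularAt L (splitFormGL L) v δ₀ := by
    rw [isEpsRegularAt_iff, hN]; exact hγ₀
  -- the core-one Haar measure on `T′`
  obtain ⟨τ', hτH, hτI, h1⟩ := exists_isHaarMeasure_epsCentralizer_compactCore_eq_one hγ₀ hδ₀T hδ₀reg
  -- the twisted family (`T′` is ε-fixed and central in the abelian `T̃`)
  have hT' := mem_epsCentralizer_base_iff hγ₀ hδ₀T hδ₀reg
  obtain ⟨Ψ, hΨ⟩ := exists_twistedConjFamily (epsLoc L (splitFormGL L) v) (Subgroup.centralizer ({(γ₀.val : GtLoc L v)} : Set (GtLoc L v))) (epsCentralizer (epsLoc L (splitFormGL L) v) δ₀)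
    (fun u hu => ((hT' u).1 hu).2) (fun u hu t ht => mul_comm_of_mem_centralizer_of_isRegularElt hγ₀ ((hT' u).1 hu).1 ht)
  -- the ε-normaliser
  obtain ⟨N', hN'⟩ := exists_epsNormalizer L (splitFormGL L) v γ₀
  -- the Borel norm section, codomain restricted to `T̃`
  obtain ⟨s, hsm, hs⟩ := exists_measurable_epsNormSection L v γ₀ T hT.le
  -- the sheet transversal
  obtain ⟨R, hRN, hRcov, hRinj⟩ := exists_normTransversal_of_cover_splitFormGL hns hγ₀
  exact ⟨δ₀, hδ₀T, hδ₀reg, τ', hτH, hτI, h1, Ψ, hΨ, N', hN', fun t => ⟨s t, (hs t).1⟩, hsm.subtype_mk, fun t => (hs t).2, R, hRN, hRcov, hRinj⟩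

end Apparatus

end Summit.HodgeConjecture.HodgeConjecture.R90.S4

end
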